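import Literature.Analysis.FluidPDE.HouLeiLiEstimate
import Literature.Analysis.FluidPDE.NSStrongSpeedBound
import HarnessLib

/-!
# Lei–Zhang 2017, §3–§4: `‖v^r/r‖_{L^∞} ≲ ‖Ω‖_{L²}^{1/2} ‖∂_zΩ‖_{L²}^{1/2}` (Lemma 2.1 + Agmon)

Analysis/FluidPDE proof file (all results proved; no definitions, no named facts) on the
decomposition path of the named fact
`Literature.Analysis.FluidPDE.LeiZhang2017_smallSwirl_regularity` (Z. Lei, Q. S. Zhang,
Pacific J. Math. 289 (2017) = arXiv:1505.02628, Thm. 1.4). The estimate driving both §3 and §4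
of the paper is (p. 9, p. 10)

> "by using Lemma 2.1 and three dimensional interpolation inequality
> `‖f‖²_{L^∞} ≲ ‖∇f‖_{L²}‖∇²f‖_{L²}`, one has
> `‖v^r/r‖_{L^∞} ≲ ‖∇(v^r/r)‖_{L²}^{1/2}‖∇²(v^r/r)‖_{L²}^{1/2} ≲ ‖Ω‖_{L²}^{1/2}‖∂_zΩ‖_{L²}^{1/2}`."

Here the interpolation inequality is Agmon's inequality in the Laplacian form proved in the tree
(`abs_le_agmon_two_param`, `NSStrongSpeedBound.lean`, Robinson–Rodrigo–Sadowski 2016,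
Thm. 1.20), optimised in its parameter:

* `abs_le_agmon_optimised` — for `φ ∈ C²(ℝ³)` with `φ ∈ L²`, `∫|∇φ|² < ∞`, `(Δφ)² ∈ L¹`:
  `|φ(x)| ≤ C_A (∫|∇φ|² · ∫(Δφ)²)^{1/4}` with the absolute constant
  `C_A = √N + Λ C_S` of `abs_le_agmon_two_param`;
* `IsAxisymmetric.abs_radVelQuot_le` —
  **`|u^r/r (x)| ≤ C_A (∫ (ω^θ/r)² · ∫ (∂_z(ω^θ/r))²)^{1/4}`**
  for an axisymmetric divergence-free `u ∈ C⁵` with the square-integrability hypotheses of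
  Lemma 2.1 (`HouLeiLiEstimate.lean`: `∫|∇ρ|² ≤ ∫ω₁²`, `∫(Δρ)² ≤ ∫(∂_zω₁)²`).

## Mathlib / tree search

Tree: `abs_le_agmon_two_param`, `gradL2`, `newtonNearSqInt`, `newtonFarLaplacianL65`
(`NSStrongSpeedBound`); `IsAxisymmetric.integral_gradSq_radVelQuot_le`,
`IsAxisymmetric.integral_laplacian_radVelQuot_sq_le` (`HouLeiLiEstimate`);
`frobeniusNormSq_eq_sum` (`VectorCalculus`). `lean search 'agmon_optimised|abs_radVelQuot_le'`:
nothing before this file.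

## References

* Z. Lei, Q. S. Zhang, Pacific J. Math. 289 (2017) = arXiv:1505.02628, §3 (p. 9) and §4
  (p. 10): the bound for `v^r/r`. [LeiZhang2017]
* J. C. Robinson, J. L. Rodrigo, W. Sadowski, *The Three-Dimensional Navier–Stokes Equations*,
  CUP 2016, Thm. 1.20 (Agmon's inequality). [RobinsonRodrigoSadowski2016]
-/

noncomputable section

open MeasureTheory Set Function Filter Topology
open scoped ContDiff Laplacian ENNReal NNReal

namespace Literature.Analysis.FluidPDE

/-! ### Agmon's inequality, optimised -/

section Agmon

variable {φ : EuclideanSpace ℝ (Fin 3) → ℝ}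

/-- **Agmon's inequality on `ℝ³`, homogeneous form**: for `φ ∈ C²` with `φ ∈ L²`, `∫|∇φ|² < ∞`
and `(Δφ)² ∈ L¹`, every `x`:
`|φ(x)| ≤ (√N + Λ C_S) (∫|∇φ|² · ∫(Δφ)²)^{1/4}` (the two-parameter bound
`abs_le_agmon_two_param` with `ρ = ((∫|∇φ|² + δ)/(∫(Δφ)² + δ))^{1/2}`, `δ → 0⁺`;
Robinson–Rodrigo–Sadowski 2016, Thm. 1.20: `‖u‖_∞ ≤ c‖u‖_{H¹}^{1/2}‖u‖_{H²}^{1/2}`).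
[cite: RobinsonRodrigoSadowski2016, Thm. 1.20] -/
theorem abs_le_agmon_optimised (hφ : ContDiff ℝ 2 φ) (h2 : MemLp φ 2 volume)
    (hD : gradL2 φ < ⊤) (hΔ : Integrable fun z => (Δ φ) z ^ 2) (x : EuclideanSpace ℝ (Fin 3)) :
    |φ x| ≤ (Real.sqrt newtonNearSqInt + newtonFarLaplacianL65 *
        SNormLESNormFDerivOfEqConst ℝ (volume : Measure (EuclideanSpace ℝ (Fin 3))) 2) *
      ((gradL2 φ).toReal * ∫ z, (Δ φ) z ^ 2) ^ (1 / 4 : ℝ) := by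
  set a₁ : ℝ := (gradL2 φ).toReal with ha₁
  set a₂ : ℝ := ∫ z, (Δ φ) z ^ 2 with ha₂
  have ha₁0 : 0 ≤ a₁ := ENNReal.toReal_nonneg
  have ha₂0 : 0 ≤ a₂ := integral_nonneg fun z => sq_nonneg _
  set P := Real.sqrt newtonNearSqInt with hP
  set Q := newtonFarLaplacianL65 *
    SNormLESNormFDerivOfEqConst ℝ (volume : Measure (EuclideanSpace ℝ (Fin 3))) 2 with hQ
  have hP0 : 0 ≤ P := Real.sqrt_nonneg _
  have hQ0 : 0 ≤ Q := mul_nonneg newtonFarLaplacianL65_nonneg (NNReal.coe_nonneg _)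
  -- the bound for every `δ > 0`
  have key : ∀ δ : ℝ, 0 < δ → |φ x| ≤ (P + Q) * ((a₁ + δ) * (a₂ + δ)) ^ (1 / 4 : ℝ) := by
    intro δ hδ
    set A := a₁ + δ with hA
    set B := a₂ + δ with hB
    have hA0 : 0 < A := by positivity
    have hB0 : 0 < B := by positivity
    set ρ := (A / B) ^ (1 / 2 : ℝ) with hρ_def
    have hρ : 0 < ρ := Real.rpow_pos_of_pos (div_pos hA0 hB0) _
    have hA4 : A ^ (1 / 2 : ℝ) = A ^ (1 / 4 : ℝ) * A ^ (1 / 4 : ℝ) := by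
      rw [← Real.rpow_add hA0]; norm_num
    have hB4 : B ^ (1 / 2 : ℝ) = B ^ (1 / 4 : ℝ) * B ^ (1 / 4 : ℝ) := by
      rw [← Real.rpow_add hB0]; norm_num
    have hAB4 : (A * B) ^ (1 / 4 : ℝ) = A ^ (1 / 4 : ℝ) * B ^ (1 / 4 : ℝ) :=
      Real.mul_rpow hA0.le hB0.le
    have hρhalf : ρ ^ (1 / 2 : ℝ) = A ^ (1 / 4 : ℝ) / B ^ (1 / 4 : ℝ) := by
      rw [hρ_def, ← Real.rpow_mul (div_pos hA0 hB0).le, Real.div_rpow hA0.le hB0.le]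
      norm_num
    have hρnhalf : ρ ^ (-(1 / 2 : ℝ)) = B ^ (1 / 4 : ℝ) / A ^ (1 / 4 : ℝ) := by
      rw [Real.rpow_neg hρ.le, hρhalf, inv_div]
    have hA40 : 0 < A ^ (1 / 4 : ℝ) := Real.rpow_pos_of_pos hA0 _
    have hB40 : 0 < B ^ (1 / 4 : ℝ) := Real.rpow_pos_of_pos hB0 _
    have e1 : ρ ^ (1 / 2 : ℝ) * B ^ (1 / 2 : ℝ) = (A * B) ^ (1 / 4 : ℝ) := by
      rw [hρhalf, hB4, hAB4]
      field_simp
    have e2 : ρ ^ (-(1 / 2 : ℝ)) * A ^ (1 / 2 : ℝ) = (A * B) ^ (1 / 4 : ℝ) := by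
      rw [hρnhalf, hA4, hAB4]
      field_simp
    have h := abs_le_agmon_two_param hφ h2 hD hΔ hρ x
    rw [← ha₂] at h
    have t1 : Real.sqrt (ρ * newtonNearSqInt) * Real.sqrt a₂ ≤ P * (A * B) ^ (1 / 4 : ℝ) := by
      have : Real.sqrt (ρ * newtonNearSqInt) * Real.sqrt a₂ =
          P * (Real.sqrt ρ * Real.sqrt a₂) := by
        rw [hP, Real.sqrt_mul hρ.le newtonNearSqInt]
        ring
      rw [this]
      refine mul_le_mul_of_nonneg_left ?_ hP0
      rw [Real.sqrt_eq_rpow, Real.sqrt_eq_rpow, ← e1]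
      exact mul_le_mul_of_nonneg_left (Real.rpow_le_rpow ha₂0 (by linarith) (by norm_num))
        (Real.rpow_nonneg hρ.le _)
    have t2 : newtonFarLaplacianL65 * ρ ^ (-(1 / 2 : ℝ)) *
        (SNormLESNormFDerivOfEqConst ℝ (volume : Measure (EuclideanSpace ℝ (Fin 3))) 2 *
          a₁ ^ (1 / 2 : ℝ)) ≤ Q * (A * B) ^ (1 / 4 : ℝ) := by
      have : newtonFarLaplacianL65 * ρ ^ (-(1 / 2 : ℝ)) *
          (SNormLESNormFDerivOfEqConst ℝ (volume : Measure (EuclideanSpace ℝ (Fin 3))) 2 *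
            a₁ ^ (1 / 2 : ℝ)) = Q * (ρ ^ (-(1 / 2 : ℝ)) * a₁ ^ (1 / 2 : ℝ)) := by
        rw [hQ]; ring
      rw [this, ← e2]
      refine mul_le_mul_of_nonneg_left ?_ hQ0
      exact mul_le_mul_of_nonneg_left (Real.rpow_le_rpow ha₁0 (by linarith) (by norm_num))
        (Real.rpow_nonneg hρ.le _)
    calc |φ x| ≤ _ := h
      _ ≤ P * (A * B) ^ (1 / 4 : ℝ) + Q * (A * B) ^ (1 / 4 : ℝ) := add_le_add t1 t2
      _ = (P + Q) * (A * B) ^ (1 / 4 : ℝ) := by ring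
  -- `δ → 0⁺`
  have hcont : Tendsto (fun δ : ℝ => (P + Q) * ((a₁ + δ) * (a₂ + δ)) ^ (1 / 4 : ℝ)) (𝓝[>] 0)
      (𝓝 ((P + Q) * ((a₁ + 0) * (a₂ + 0)) ^ (1 / 4 : ℝ))) := by
    refine tendsto_nhdsWithin_of_tendsto_nhds (Continuous.tendsto ?_ 0)
    refine continuous_const.mul ?_
    exact ((continuous_const.add continuous_id).mul (continuous_const.add continuous_id)).rpow_const
      fun _ => Or.inr (by norm_num)
  rw [add_zero, add_zero] at hcont
  exact ge_of_tendsto hcont (eventually_nhdsWithin_of_forall fun δ hδ => key δ hδ)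

/-- For a `C¹` scalar on `ℝ³`, `|∇φ|²_F = (∂₀φ)² + (∂₁φ)² + (∂₂φ)²`. [folklore] -/
theorem frobeniusNormSq_fderiv_scalar (φ : EuclideanSpace ℝ (Fin 3) → ℝ)
    (x : EuclideanSpace ℝ (Fin 3)) :
    frobeniusNormSq (fderiv ℝ φ x) = fderiv ℝ φ x (EuclideanSpace.single 0 1) ^ 2 +
      fderiv ℝ φ x (EuclideanSpace.single 1 1) ^ 2 +
      fderiv ℝ φ x (EuclideanSpace.single 2 1) ^ 2 := by
  rw [frobeniusNormSq_eq_sum (EuclideanSpace.basisFun (Fin 3) ℝ)]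
  simp only [EuclideanSpace.basisFun_apply, Fin.sum_univ_three, Real.norm_eq_abs, sq_abs]

/-- `gradL2 φ = ofReal (∫ ((∂₀φ)² + (∂₁φ)² + (∂₂φ)²))` when the three partial derivatives are in
`L²`. [folklore] -/
theorem gradL2_eq_ofReal_integral {φ : EuclideanSpace ℝ (Fin 3) → ℝ}
    (h0 : MemLp (fun x => fderiv ℝ φ x (EuclideanSpace.single 0 1)) 2 volume)
    (h1 : MemLp (fun x => fderiv ℝ φ x (EuclideanSpace.single 1 1)) 2 volume)
    (h2 : MemLp (fun x => fderiv ℝ φ x (EuclideanSpace.single 2 1)) 2 volume) :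
    gradL2 φ = ENNReal.ofReal (∫ x, (fderiv ℝ φ x (EuclideanSpace.single 0 1) ^ 2 +
      fderiv ℝ φ x (EuclideanSpace.single 1 1) ^ 2 +
      fderiv ℝ φ x (EuclideanSpace.single 2 1) ^ 2)) := by
  have hint : Integrable fun x => fderiv ℝ φ x (EuclideanSpace.single 0 1) ^ 2 +
      fderiv ℝ φ x (EuclideanSpace.single 1 1) ^ 2 +
      fderiv ℝ φ x (EuclideanSpace.single 2 1) ^ 2 :=
    (h0.integrable_sq.add h1.integrable_sq).add h2.integrable_sq
  rw [ofReal_integral_eq_lintegral_ofReal hint (ae_of_all _ fun x => by positivity)]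
  simp only [gradL2, frobeniusNormSq_fderiv_scalar]

end Agmon

/-! ### The sup bound for `u^r/r` -/

section SupBound

variable {u : EuclideanSpace ℝ (Fin 3) → EuclideanSpace ℝ (Fin 3)}

/-- **`‖v^r/r‖_{L^∞} ≲ ‖Ω‖_{L²}^{1/2}‖∂_zΩ‖_{L²}^{1/2}`** (Lei–Zhang 2017, §3 p. 9 and §4 p. 10,
from Lemma 2.1 and the interpolation inequality `‖f‖²_{L^∞} ≲ ‖∇f‖_{L²}‖∇²f‖_{L²}`): for an
axisymmetric divergence-free `u ∈ C⁵` with the square-integrability hypotheses of Lemma 2.1,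
every `x`:
`|u^r/r (x)| ≤ C_A (∫ (ω^θ/r)² · ∫ (∂_z(ω^θ/r))²)^{1/4}`, `C_A = √N + Λ C_S` absolute.
[cite: LeiZhang2017, §4 (p. 10): ‖v^r/r‖_{L^∞} ≲ ‖Ω‖^{1/2}_{L²}‖∂_zΩ‖^{1/2}_{L²}, from Lemma 2.1] -/
theorem IsAxisymmetric.abs_radVelQuot_le (hax : IsAxisymmetric u) (hu : ContDiff ℝ 5 u)
    (hdiv : VectorCalculus.IsDivFree u)
    (hρ : MemLp (radVelQuot u) 2 volume) (hq : MemLp (radDerivQuot (radVelQuot u)) 2 volume)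
    (hG0 : MemLp (fun x => fderiv ℝ (radVelQuot u) x (EuclideanSpace.single 0 1)) 2 volume)
    (hG1 : MemLp (fun x => fderiv ℝ (radVelQuot u) x (EuclideanSpace.single 1 1)) 2 volume)
    (hG2 : MemLp (fun x => fderiv ℝ (radVelQuot u) x (EuclideanSpace.single 2 1)) 2 volume)
    (hG00 : MemLp (fun x =>
      fderiv ℝ (fun y => fderiv ℝ (radVelQuot u) y (EuclideanSpace.single 0 1)) x
      (EuclideanSpace.single 0 1)) 2 volume)
    (hG11 : MemLp (fun x =>
      fderiv ℝ (fun y => fderiv ℝ (radVelQuot u) y (EuclideanSpace.single 1 1)) x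
      (EuclideanSpace.single 1 1)) 2 volume)
    (hG22 : MemLp (fun x =>
      fderiv ℝ (fun y => fderiv ℝ (radVelQuot u) y (EuclideanSpace.single 2 1)) x
      (EuclideanSpace.single 2 1)) 2 volume)
    (hxq0 : MemLp (fun x => x 0 * fderiv ℝ (radDerivQuot (radVelQuot u)) x
      (EuclideanSpace.single 0 1)) 2 volume)
    (hxq1 : MemLp (fun x => x 1 * fderiv ℝ (radDerivQuot (radVelQuot u)) x
      (EuclideanSpace.single 1 1)) 2 volume)
    (hqH : MemLp (radDerivQuot fun y => fderiv ℝ (radVelQuot u) y (EuclideanSpace.single 2 1)) 2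
      volume)
    (hω : MemLp (angVortQuot u) 2 volume)
    (hωz : MemLp (fun x => fderiv ℝ (angVortQuot u) x (EuclideanSpace.single 2 1)) 2 volume)
    (x : EuclideanSpace ℝ (Fin 3)) :
    |radVelQuot u x| ≤ (Real.sqrt newtonNearSqInt + newtonFarLaplacianL65 *
        SNormLESNormFDerivOfEqConst ℝ (volume : Measure (EuclideanSpace ℝ (Fin 3))) 2) *
      ((∫ y, angVortQuot u y ^ 2) *
        ∫ y, fderiv ℝ (angVortQuot u) y (EuclideanSpace.single 2 1) ^ 2) ^ (1 / 4 : ℝ) := by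
  have hu4 : ContDiff ℝ 4 u := hu.of_le (by norm_num)
  have hρ2 : ContDiff ℝ 2 (radVelQuot u) := contDiff_radVelQuot (n := 2) (by exact_mod_cast hu4)
  -- the two estimates of Lemma 2.1
  have hgrad := hax.integral_gradSq_radVelQuot_le hu4 hdiv hρ hq hG0 hG1 hG2 hG00 hG11 hG22 hω hωz
  have hlap := hax.integral_laplacian_radVelQuot_sq_le hu hdiv hq hG0 hG1 hG2 hG00 hG11 hG22
    hxq0 hxq1 hqH
  -- the hypotheses of Agmon's inequality
  have hDeq := gradL2_eq_ofReal_integral hG0 hG1 hG2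
  have hD : gradL2 (radVelQuot u) < ⊤ := by rw [hDeq]; exact ENNReal.ofReal_lt_top
  have hLap : ∀ y, (Δ (radVelQuot u)) y =
      fderiv ℝ (fun z => fderiv ℝ (radVelQuot u) z (EuclideanSpace.single 0 1)) y
        (EuclideanSpace.single 0 1) +
      fderiv ℝ (fun z => fderiv ℝ (radVelQuot u) z (EuclideanSpace.single 1 1)) y
        (EuclideanSpace.single 1 1) +
      fderiv ℝ (fun z => fderiv ℝ (radVelQuot u) z (EuclideanSpace.single 2 1)) y
        (EuclideanSpace.single 2 1) := fun y => by
    rw [laplacian_eq_sum_fderiv_fderiv (EuclideanSpace.basisFun (Fin 3) ℝ) hρ2 y]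
    simp only [EuclideanSpace.basisFun_apply, Fin.sum_univ_three]
  have hLapL2 : MemLp (Δ (radVelQuot u)) 2 volume :=
    ((hG00.add hG11).add hG22).ae_eq (Eventually.of_forall fun y => by
      simp only [Pi.add_apply, hLap])
  have hΔ : Integrable fun z => (Δ (radVelQuot u)) z ^ 2 := hLapL2.integrable_sq
  have hA := abs_le_agmon_optimised hρ2 hρ hD hΔ x
  -- monotonicity in the two integrals
  have hgradnn : 0 ≤ ∫ y, (fderiv ℝ (radVelQuot u) y (EuclideanSpace.single 0 1) ^ 2 +
      fderiv ℝ (radVelQuot u) y (EuclideanSpace.single 1 1) ^ 2 +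
      fderiv ℝ (radVelQuot u) y (EuclideanSpace.single 2 1) ^ 2) :=
    integral_nonneg fun y => by positivity
  have htoReal : (gradL2 (radVelQuot u)).toReal =
      ∫ y, (fderiv ℝ (radVelQuot u) y (EuclideanSpace.single 0 1) ^ 2 +
        fderiv ℝ (radVelQuot u) y (EuclideanSpace.single 1 1) ^ 2 +
        fderiv ℝ (radVelQuot u) y (EuclideanSpace.single 2 1) ^ 2) := by
    rw [hDeq, ENNReal.toReal_ofReal hgradnn]
  have hlapnn : 0 ≤ ∫ z, (Δ (radVelQuot u)) z ^ 2 := integral_nonneg fun z => sq_nonneg _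
  have hC : 0 ≤ Real.sqrt newtonNearSqInt + newtonFarLaplacianL65 *
      SNormLESNormFDerivOfEqConst ℝ (volume : Measure (EuclideanSpace ℝ (Fin 3))) 2 :=
    add_nonneg (Real.sqrt_nonneg _)
      (mul_nonneg newtonFarLaplacianL65_nonneg (NNReal.coe_nonneg _))
  refine hA.trans (mul_le_mul_of_nonneg_left ?_ hC)
  refine Real.rpow_le_rpow (mul_nonneg ENNReal.toReal_nonneg hlapnn) ?_ (by norm_num)
  rw [htoReal]
  exact mul_le_mul hgrad hlap hlapnn ((hgradnn.trans hgrad))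

end SupBound

end Literature.Analysis.FluidPDE

end
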